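import Literature.MathematicalPhysics.QuantumFieldTheory.Balaban1983to89.Node00.Record9InhabitedSU1

/-!
# NODE 00 — K0 `Record9Inhabited` REDUCED TO FOUR DISPLAYED REGULARITY CLAUSES (every `N`): the delta extension of a Stage-8 parameter
# satisfies `Stage9Params.Provisos` as soon as the χ of record and the (3.2)·(3.3) label weights are MEASURABLE, the marginal density of the
# averaging transport of record is POINTWISE BOUNDED, and the support-form (0.3) clause holds at `Z″ := Z` — and nothing else

Cell `pub-ymgap`, seat `pub-ymgap-dag-n23-b` g3 (W00 datum-inhabitation lane).  Companion of `Node00/Record9InhabitedSU1` (p427314: the residual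
choices, the `N = 1` census) and of the seat's located note `K0-TYPING-CENSUS.md` (v1.1): this file is the KERNEL FORM of that note's census table.
[III] = [Balaban1988Convergent], [IV] = [Balaban1989LargeFieldI].

WHAT THIS FILE IS.
* §1 (generic in the residual data, every `N`) REGULARITY PROPAGATION through the represented tower of record: a measurable, bounded, non-negative
  slot stays so under the T-step (†) (`measurable_tstepOfRecord`, `tstepOfRecord_le_of_avgDensity_le` — Mathlib's `StronglyMeasurable.integral_kernel_prod_right'`,
  the Markov property of the averaging kernel, and a POINTWISE bound on the marginal density `avgDensity` of the averaging of record, DISPLAYED) and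
  under def-R's R-step at the identity selector (`rstepSlot_ppSelId_le`, `measurable_rstepSlot_ppSelId`: at `Z″ := Z` the R-stepped slot is the slot times
  `F∕F`, `F = ∫dV⌈_{Z′(s)} χ_k(s)·slot(s)`); hence, by induction on the level, EVERY slot of both slot families is measurable and bounded
  (`slotsOfRecord_measurable_and_bounded`, `slotsTOfRecord_measurable_and_bounded`) given measurable χ's of record, jointly measurable step weights with
  `|w| ≤ 1`, `0 ≤ w`, and the displayed density bound.
* §2 THE REDUCTION at the delta extension `stage9DeltaOfRecord θ₈` (p427314): **`provisos_stage9DeltaOfRecord_of_regularity`** — the six provisos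
  of `Record9` from FOUR DISPLAYED CLAUSES (H-χ) measurability of every `χ_k(s)` of record along the generated histories, (H-ω) joint measurability
  of the label weights `ω` of record (at `A₁ = 0`, delta `ζ`), (H-h) a pointwise bound on `avgDensity (avOfRecord F N K k).avg`, (H-supp) the
  support-form (0.3) clause for the delta extension's pre-𝐑 pieces at `Z″ := Z`; and **`exists_isRecordOfRecord₉C_of_regularity`**: with an admissible,
  charted `θ₈` the four clauses give a Stage-9 record (`IsRecordOfRecord₉C`) at every `N`.

## HONEST FRAMING — what this is NOT

* A REDUCTION, not an inhabitant: the four clauses are HYPOTHESES, displayed, never asserted.  Per the seat's note they are exactly the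
  representative-dependent rows of K0's census at `N ≥ 2`: (H-χ), (H-ω), (H-supp) are statements about objects the tree defines through
  `Classical.choose` (def-R's totalised (2.12) solution map `UminOfRecord`), (H-h) is a pointwise bound on Mathlib's Radon–Nikodym REPRESENTATIVE
  (`margDensity := rnNN …`); none is settled by analysis of Bałaban's objects without a choice-independence theorem or a re-pointing of the
  definitions of record.  The theorem's content is what DROPS OUT: `intPiece` at every level, `zetaUnity`, `zetaAbs`, the measurability,
  sign and uniform-bound conjuncts of `rstep`, and all T-step ∕ R-step plumbing.
* Nothing of Bałaban's is asserted ([III] §3, [IV] §1 not used); no node count moves; K0 of record (plan: at `F 2`) is NOT discharged here.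
* One finite four-torus programme at fixed `ε` — NOT the continuum limit on ℝ⁴, NOT infinite volume, NOT OS, NOT a mass gap, NOT the Clay problem.
-/

noncomputable section

open MeasureTheory ProbabilityTheory
open scoped BigOperators NNReal ENNReal

namespace Literature.MathematicalPhysics.QuantumFieldTheory.Balaban1983to89.Node00

open T4Continuum B14.Eq218Concrete T4AveragingDisintegration T4FiniteEpsInhabited
open B15.BasicStep (fibreIntegral ofReal_comp_measurable)
open DagBinding (WorldP)

/-! ## §1. Regularity propagation through the represented tower of record (every `N`) -/

section FibreIntegral

variable {P : Params} {j : ℕ} {G : Type*} [GaugeGroup G] [MeasurableSpace G] [HaarData G]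

/-- A restricted integral `∫dV⌈_{s} h` of a measurable density is measurable (Mathlib's `Measurable.lmarginal`; the same one-liner as
`B15Norm1102Object.measurable_fibreIntegral`, not in this file's import cone), at ANY decidability instance on the bonds (implicit, unified from
the goal — the R-step of record carries the classical one). [folklore] -/
private theorem measurable_fibreIntegral' {inst : DecidableEq (PBond P j)} (s : Finset (PBond P j)) {h : Density P j G}
    (hm : Measurable h) : Measurable (@fibreIntegral P j G _ _ _ inst s h) :=
  ((ofReal_comp_measurable hm).lmarginal (fun _ : PBond P j => (HaarData.haar : Measure G))).ennreal_toReal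

end FibreIntegral

section Generic

variable (F : T4Family) (N : ℕ) [NeZero N] (ν : Stage7Numerics) (M : ℕ)

variable {p : B12.RunParams} {g : ℕ → ℝ} {k : ℕ}

/-- **The T-step (†) of a measurable slot is measurable** — jointly measurable step weight, measurable old front factor and old slot; the
coarse-side integral against the averaging kernel is measurable by `StronglyMeasurable.integral_kernel_prod_right'`, the marginal density of
record by `measurable_margDensity`. [cite: Balaban1988Convergent, (3.1) p.264, (3.24)–(3.25) p.270 (bookkeeping)] -/
theorem measurable_tstepOfRecord {w : StepWeightsOfRecord F N ν M}
    (hw : ∀ s', Measurable (fun z : GaugeField (F.P p.K) (k + 1) (SU N) × GaugeField (F.P p.K) k (SU N) => w p g k s' z.2 z.1))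
    {T : SeqOfRecord F ν M g p.K k → Density (F.P p.K) k (SU N)} (hT : ∀ s, Measurable (T s))
    (hχ : ∀ s, Measurable (chiSeqOfRecord F N ν M g p.K k s)) (s' : SeqOfRecord F ν M g p.K (k + 1)) :
    Measurable (tstepOfRecord F N ν M w p g k T s') := by
  have e : tstepOfRecord F N ν M w p g k T s' = fun V' => (avgDensity (avOfRecord F N p.K k).avg V' : ℝ) *
      ∫ U, w p g k s' U V' * (chiSeqOfRecord F N ν M g p.K k s'.init U * T s'.init U) ∂(avgKernel (avOfRecord F N p.K k).avg V') :=
    funext fun V' => texpASucc_apply _ _ _ _ s' V'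
  rw [e]
  have hf : Measurable (fun z : GaugeField (F.P p.K) (k + 1) (SU N) × GaugeField (F.P p.K) k (SU N) =>
      w p g k s' z.2 z.1 * (chiSeqOfRecord F N ν M g p.K k s'.init z.2 * T s'.init z.2)) :=
    (hw s').mul (((hχ _).comp measurable_snd).mul ((hT _).comp measurable_snd))
  have hI : StronglyMeasurable (fun V' : GaugeField (F.P p.K) (k + 1) (SU N) =>
      ∫ U, w p g k s' U V' * (chiSeqOfRecord F N ν M g p.K k s'.init U * T s'.init U) ∂(avgKernel (avOfRecord F N p.K k).avg V')) :=
    hf.stronglyMeasurable.integral_kernel_prod_right'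
  exact measurable_margDensity.coe_nnreal_real.mul hI.measurable

/-- **The T-step (†) of a bounded non-negative slot is bounded, GIVEN A POINTWISE BOUND ON THE MARGINAL DENSITY OF RECORD** (displayed: `avgDensity` is
an `rnDeriv` representative): `|w| ≤ 1`, `0 ≤ χ_k ≤ 1`, `0 ≤ slot ≤ C_T` and `avgDensity ≤ C_h` give `T-slot ≤ C_h · C_T` (the averaging kernel is
Markov). [cite: Balaban1988Convergent, (3.1) p.264, (3.24)–(3.25) p.270 (bookkeeping)] -/
theorem tstepOfRecord_le_of_avgDensity_le {w : StepWeightsOfRecord F N ν M} (hwb : ∀ s' U V', |w p g k s' U V'| ≤ 1)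
    {T : SeqOfRecord F ν M g p.K k → Density (F.P p.K) k (SU N)} (hT0 : ∀ s U, 0 ≤ T s U) {CT : ℝ} (hTC : ∀ s U, T s U ≤ CT)
    {Ch : ℝ} (hh : ∀ V', (avgDensity (avOfRecord F N p.K k).avg V' : ℝ) ≤ Ch)
    (s' : SeqOfRecord F ν M g p.K (k + 1)) (V' : GaugeField (F.P p.K) (k + 1) (SU N)) :
    tstepOfRecord F N ν M w p g k T s' V' ≤ Ch * CT := by
  rw [show tstepOfRecord F N ν M w p g k T s' V' = (avgDensity (avOfRecord F N p.K k).avg V' : ℝ) *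
      ∫ U, w p g k s' U V' * (chiSeqOfRecord F N ν M g p.K k s'.init U * T s'.init U) ∂(avgKernel (avOfRecord F N p.K k).avg V')
    from texpASucc_apply _ _ _ _ s' V']
  obtain ⟨U₀⟩ : Nonempty (GaugeField (F.P p.K) k (SU N)) := ⟨fun _ => 1⟩
  have hCT : 0 ≤ CT := (hT0 s'.init U₀).trans (hTC s'.init U₀)
  have hbound : ∀ U, ‖w p g k s' U V' * (chiSeqOfRecord F N ν M g p.K k s'.init U * T s'.init U)‖ ≤ CT := by
    intro U
    rw [Real.norm_eq_abs, abs_mul, abs_mul, abs_of_nonneg (chiSeqOfRecord_nonneg F N ν M g p.K k s'.init U),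
      abs_of_nonneg (hT0 s'.init U)]
    calc |w p g k s' U V'| * (chiSeqOfRecord F N ν M g p.K k s'.init U * T s'.init U)
        ≤ 1 * (1 * CT) := mul_le_mul (hwb s' U V') (mul_le_mul (chiSeqOfRecord_le_one F N ν M g p.K k s'.init U) (hTC s'.init U)
          (hT0 s'.init U) zero_le_one) (mul_nonneg (chiSeqOfRecord_nonneg F N ν M g p.K k s'.init U) (hT0 s'.init U)) zero_le_one
      _ = CT := by ring
  have hI : ∫ U, w p g k s' U V' * (chiSeqOfRecord F N ν M g p.K k s'.init U * T s'.init U) ∂(avgKernel (avOfRecord F N p.K k).avg V') ≤ CT := by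
    have h := norm_integral_le_of_norm_le_const (μ := avgKernel (avOfRecord F N p.K k).avg V') (ae_of_all _ hbound)
    rw [probReal_univ, mul_one, Real.norm_eq_abs] at h
    exact (le_abs_self _).trans h
  have h0 : 0 ≤ (avgDensity (avOfRecord F N p.K k).avg V' : ℝ) := NNReal.coe_nonneg _
  calc (avgDensity (avOfRecord F N p.K k).avg V' : ℝ) * _ ≤ (avgDensity (avOfRecord F N p.K k).avg V' : ℝ) * CT :=
        mul_le_mul_of_nonneg_left hI h0
    _ ≤ Ch * CT := mul_le_mul_of_nonneg_right (hh V') hCT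

/-- A finite sum over all indices of a term supported at one index is that term (any decidability, any `Fintype` structure — both implicit,
unified from the goal). [folklore] -/
private theorem sum_univ_ite_eq {ι β : Type*} [AddCommMonoid β] {instF : Fintype ι} (s : ι) (T : ι → β)
    (d : ∀ a, Decidable (a = s)) : (∑ a ∈ @Finset.univ ι instF, @ite β (a = s) (d a) (T a) 0) = T s := by
  rw [Finset.sum_eq_single_of_mem s (Finset.mem_univ _) (fun b _ hb => by rw [if_neg hb]), if_pos rfl]

variable (τ : TowerNumerics)

/-- **The R-step at the identity selector does not increase a non-negative slot**: at `Z″ := Z` the R-stepped slot is the slot times a single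
ratio `F∕F ∈ {0, 1}`, `F = ∫dV⌈_{Z′(s)} χ_k(s)·slot(s)`. [cite: Balaban1989LargeFieldI, (0.3) p.176 (bookkeeping)] -/
theorem rstepSlot_ppSelId_le {f : TexpASlot F N ν τ.M p g k} (hf : ∀ s V, 0 ≤ f s V) (s : SeqOfRecord F ν τ.M g p.K k)
    (V : GaugeField (F.P p.K) k (SU N)) :
    rstepSlot F N ν τ p g k (ppSelIdOfRecord F ν τ.M p g k) f s V ≤ f s V := by
  unfold rstepSlot rstepOfSel ppSelIdOfRecord
  dsimp only
  simp only [Finset.sum_filter, sum_univ_ite_eq]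
  unfold rratio
  exact mul_le_of_le_one_right (hf s V) (div_self_le_one _)

/-- **The R-step at the identity selector keeps measurability**: measurable `χ_k(s)` and measurable slot give a measurable R-stepped slot (the ratio's
restricted integrals are measurable by `Measurable.lmarginal`). [cite: Balaban1989LargeFieldI, (0.3) p.176 (bookkeeping)] -/
theorem measurable_rstepSlot_ppSelId {f : TexpASlot F N ν τ.M p g k} (hf : ∀ s, Measurable (f s))
    (hχ : ∀ s, Measurable (chiSeqOfRecord F N ν τ.M g p.K k s)) (s : SeqOfRecord F ν τ.M g p.K k) :
    Measurable (rstepSlot F N ν τ p g k (ppSelIdOfRecord F ν τ.M p g k) f s) := by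
  unfold rstepSlot rstepOfSel ppSelIdOfRecord
  dsimp only
  simp only [Finset.sum_filter, sum_univ_ite_eq]
  have hm : Measurable (rterm (sliceOfRecord F N ν τ.M p g k f) s) := (hχ s).mul (hf s)
  unfold rratio
  exact (hf s).mul ((measurable_fibreIntegral' _ hm).div (measurable_fibreIntegral' _ hm))

/-- **EVERY POST-𝐑 SLOT OF THE REPRESENTED TOWER OF RECORD IS MEASURABLE AND BOUNDED** at the identity selector, GIVEN measurable χ's of record,
jointly measurable step weights with `|w| ≤ 1` and `0 ≤ w`, and a pointwise bound on the marginal densities of record (induction on the level: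
`ρ₀ = e^{−E}·e^{−A∕g₀²} ≤ e^{−E}`, then T-step and R-step). [cite: Balaban1988Convergent, (2.18) p.257, (3.24)–(3.25) p.270; Balaban1989LargeFieldI, (0.3) p.176 (bookkeeping)] -/
theorem slotsOfRecord_measurable_and_bounded (E : B12.RunParams → ℝ) {w : StepWeightsOfRecord F N ν τ.M}
    (hw : ∀ k s', Measurable (fun z : GaugeField (F.P p.K) (k + 1) (SU N) × GaugeField (F.P p.K) k (SU N) => w p g k s' z.2 z.1))
    (hwb : ∀ k s' U V', |w p g k s' U V'| ≤ 1) (hw0 : ∀ p g k s' U V', 0 ≤ w p g k s' U V')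
    (hχ : ∀ k s, Measurable (chiSeqOfRecord F N ν τ.M g p.K k s))
    (hh : ∀ k, ∃ C : ℝ, ∀ V', (avgDensity (avOfRecord F N p.K k).avg V' : ℝ) ≤ C) :
    ∀ k, (∀ s, Measurable (slotsOfRecord F N ν τ E w (ppSelIdOfRecord F ν τ.M) p g k s)) ∧
      ∃ C : ℝ, ∀ s V, slotsOfRecord F N ν τ E w (ppSelIdOfRecord F ν τ.M) p g k s V ≤ C := by
  intro k
  induction k with
  | zero =>
    refine ⟨fun s => ?_, Real.exp (-E p), fun s V => ?_⟩
    · show Measurable (rhoZeroOfRecord F N p.K (g 0) (E p))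
      exact (Missing.measurable_boltzmann RegularGaugeGroup.measurable_reTr (F.P p.K) _).const_mul _
    · show Real.exp (-E p) * Missing.boltzmann (F.P p.K) ((g 0)⁻¹ ^ 2) V ≤ Real.exp (-E p)
      exact mul_le_of_le_one_right (Real.exp_pos _).le (Missing.boltzmann_le_one (F.P p.K) (sq_nonneg _) V)
  | succ k ih =>
    obtain ⟨hm, CT, hCT⟩ := ih
    obtain ⟨Ch, hCh⟩ := hh k
    have h0 : ∀ s U, 0 ≤ slotsOfRecord F N ν τ E w (ppSelIdOfRecord F ν τ.M) p g k s U :=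
      slotsOfRecord_nonneg F N ν τ E hw0 _ p g k
    have hTm : ∀ s', Measurable (slotsTOfRecord F N ν τ E w (ppSelIdOfRecord F ν τ.M) p g (k + 1) s') := fun s' => by
      rw [slotsTOfRecord_succ]
      exact measurable_tstepOfRecord F N ν τ.M (hw k) hm (hχ k) s'
    have hTb : ∀ s' V', slotsTOfRecord F N ν τ E w (ppSelIdOfRecord F ν τ.M) p g (k + 1) s' V' ≤ Ch * CT := fun s' V' => by
      rw [slotsTOfRecord_succ]
      exact tstepOfRecord_le_of_avgDensity_le F N ν τ.M (hwb k) h0 hCT hCh s' V'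
    have hT0 : ∀ s' V', 0 ≤ slotsTOfRecord F N ν τ E w (ppSelIdOfRecord F ν τ.M) p g (k + 1) s' V' :=
      slotsTOfRecord_nonneg F N ν τ E hw0 _ p g (k + 1)
    refine ⟨fun s => ?_, Ch * CT, fun s V => ?_⟩
    · rw [slotsOfRecord_succ]
      exact measurable_rstepSlot_ppSelId F N ν τ hTm (hχ (k + 1)) s
    · rw [slotsOfRecord_succ]
      exact (rstepSlot_ppSelId_le F N ν τ hT0 s V).trans (hTb s V)

/-- … hence EVERY PRE-𝐑 SLOT (the slots of `𝐓ρ_k`) is measurable and bounded, level `k + 1`. [cite: Balaban1988Convergent, (3.24)–(3.25) p.270 (bookkeeping)] -/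
theorem slotsTOfRecord_measurable_and_bounded (E : B12.RunParams → ℝ) {w : StepWeightsOfRecord F N ν τ.M}
    (hw : ∀ k s', Measurable (fun z : GaugeField (F.P p.K) (k + 1) (SU N) × GaugeField (F.P p.K) k (SU N) => w p g k s' z.2 z.1))
    (hwb : ∀ k s' U V', |w p g k s' U V'| ≤ 1) (hw0 : ∀ p g k s' U V', 0 ≤ w p g k s' U V')
    (hχ : ∀ k s, Measurable (chiSeqOfRecord F N ν τ.M g p.K k s))
    (hh : ∀ k, ∃ C : ℝ, ∀ V', (avgDensity (avOfRecord F N p.K k).avg V' : ℝ) ≤ C) (k : ℕ) :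
    (∀ s', Measurable (slotsTOfRecord F N ν τ E w (ppSelIdOfRecord F ν τ.M) p g (k + 1) s')) ∧
      ∃ C : ℝ, ∀ s' V', slotsTOfRecord F N ν τ E w (ppSelIdOfRecord F ν τ.M) p g (k + 1) s' V' ≤ C := by
  obtain ⟨hm, CT, hCT⟩ := slotsOfRecord_measurable_and_bounded F N ν τ E hw hwb hw0 hχ hh k
  obtain ⟨Ch, hCh⟩ := hh k
  refine ⟨fun s' => ?_, Ch * CT, fun s' V' => ?_⟩
  · rw [slotsTOfRecord_succ]
    exact measurable_tstepOfRecord F N ν τ.M (hw k) hm (hχ k) s'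
  · rw [slotsTOfRecord_succ]
    exact tstepOfRecord_le_of_avgDensity_le F N ν τ.M (hwb k) (slotsOfRecord_nonneg F N ν τ E hw0 _ p g k) hCT hCh s' V'

end Generic

/-! ## §2. The reduction at the delta extension -/

section Reduction

variable (F : T4Family) (N : ℕ) [NeZero N]

/-- **K0 REDUCED TO FOUR DISPLAYED REGULARITY CLAUSES (every `N`)**: the delta extension `stage9DeltaOfRecord θ₈` of ANY Stage-8 parameter satisfies its
displayed provisos `Stage9Params.Provisos` provided (H-χ) every `χ_k(s)` of record along the generated histories is measurable, (H-ω) the label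
weights `ω` of record (at `A₁ = 0`, delta `ζ`) are jointly measurable in `(V′, U)`, (H-h) the marginal density of the averaging transport of record
is pointwise bounded at every `(K, k)`, (H-supp) the support-form (0.3) clause holds for the delta extension's pre-𝐑 pieces at `Z″ := Z`.
`intPiece` (every level: bounded measurable on a probability space), the two ζ-laws, and the measurability ∕ sign ∕ bound conjuncts of `rstep` DROP
OUT.  The four clauses are DISPLAYED HYPOTHESES — (H-χ), (H-ω), (H-supp) about `Classical.choose`-defined objects, (H-h) about an `rnDeriv`
representative — never asserted. [cite: Balaban1988Convergent, (2.18) p.257, (3.1)–(3.9) pp.264–266, (3.16) p.268, (3.24)–(3.25) p.270; Balaban1989LargeFieldI, (0.3)–(0.4) p.176 (the provisos reduced; bookkeeping)] -/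
theorem provisos_stage9DeltaOfRecord_of_regularity (θ₈ : Stage8Params F N)
    (hχ : ∀ (p : B12.RunParams) (k : ℕ) (s : SeqOfRecord F θ₈.ν 1 (gOfRecord₉ F N (stage9DeltaOfRecord F N θ₈) p) p.K k),
      Measurable (chiSeqOfRecord F N θ₈.ν 1 (gOfRecord₉ F N (stage9DeltaOfRecord F N θ₈) p) p.K k s))
    (hω : ∀ (p : B12.RunParams) (k : ℕ) (s : SeqOfRecord F θ₈.ν 1 (gOfRecord₉ F N (stage9DeltaOfRecord F N θ₈) p) p.K k)
      (t : LbOfRecord F θ₈.ν p (gOfRecord₉ F N (stage9DeltaOfRecord F N θ₈) p) k),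
      Measurable (fun z : GaugeField (F.P p.K) (k + 1) (SU N) × GaugeField (F.P p.K) k (SU N) =>
        ωOfRecord F N θ₈.ν 1 p (gOfRecord₉ F N (stage9DeltaOfRecord F N θ₈) p) k 0 (zetaDeltaOfRecord F N θ₈.ν 1) s t z.2 z.1))
    (hh : ∀ K k : ℕ, ∃ C : ℝ, ∀ V', (avgDensity (avOfRecord F N K k).avg V' : ℝ) ≤ C)
    (hsupp : ∀ (p : B12.RunParams) (k : ℕ) [DecidableEq (PBond (F.P p.K) (k + 1))]
      (s : SeqOfRecord F θ₈.ν 1 (gOfRecord₉ F N (stage9DeltaOfRecord F N θ₈) p) p.K (k + 1)) (V : GaugeField (F.P p.K) (k + 1) (SU N)),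
      fibreIntegral (fibOfSeq F θ₈.ν ⟨1, 0, 0⟩ p (gOfRecord₉ F N (stage9DeltaOfRecord F N θ₈) p) (k + 1) s)
        (fun V => chiSeqOfRecord F N θ₈.ν 1 (gOfRecord₉ F N (stage9DeltaOfRecord F N θ₈) p) p.K (k + 1) s V *
          slotsTOfRecord F N θ₈.ν ⟨1, 0, 0⟩ (EOfRecord₉ F N (stage9DeltaOfRecord F N θ₈)) (wOfRecord₉ F N (stage9DeltaOfRecord F N θ₈))
            (ppSelIdOfRecord F θ₈.ν 1) p (gOfRecord₉ F N (stage9DeltaOfRecord F N θ₈) p) (k + 1) s V) V = 0 →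
      chiSeqOfRecord F N θ₈.ν 1 (gOfRecord₉ F N (stage9DeltaOfRecord F N θ₈) p) p.K (k + 1) s V *
        slotsTOfRecord F N θ₈.ν ⟨1, 0, 0⟩ (EOfRecord₉ F N (stage9DeltaOfRecord F N θ₈)) (wOfRecord₉ F N (stage9DeltaOfRecord F N θ₈))
          (ppSelIdOfRecord F θ₈.ν 1) p (gOfRecord₉ F N (stage9DeltaOfRecord F N θ₈) p) (k + 1) s V = 0) :
    (stage9DeltaOfRecord F N θ₈).Provisos := by
  -- the step weights of the delta extension: jointly measurable (from (H-ω)), `|w| ≤ 1`, `0 ≤ w`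
  have hw : ∀ (p : B12.RunParams) (k : ℕ) (s' : SeqOfRecord F θ₈.ν 1 (gOfRecord₉ F N (stage9DeltaOfRecord F N θ₈) p) p.K (k + 1)),
      Measurable (fun z : GaugeField (F.P p.K) (k + 1) (SU N) × GaugeField (F.P p.K) k (SU N) =>
        wOfRecord₉ F N (stage9DeltaOfRecord F N θ₈) p (gOfRecord₉ F N (stage9DeltaOfRecord F N θ₈) p) k s' z.2 z.1) :=
    fun p k s' => measurable_wOfRecord F N θ₈.ν 1 0 (zetaDeltaOfRecord F N θ₈.ν 1) p _ k (hω p k) s'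
  have hwb : ∀ (p : B12.RunParams) (k : ℕ) s' U V',
      |wOfRecord₉ F N (stage9DeltaOfRecord F N θ₈) p (gOfRecord₉ F N (stage9DeltaOfRecord F N θ₈) p) k s' U V'| ≤ 1 :=
    fun p k s' U V' => abs_wOfRecord_le_one F N θ₈.ν 1 0 (isZetaAbsLeOne_zetaDeltaOfRecord F N θ₈.ν 1) p _ k s' U V'
  have hw0 := wOfRecord₉_stage9DeltaOfRecord_nonneg F N θ₈
  -- every slot of both families is measurable and bounded
  have hreg := fun p => slotsOfRecord_measurable_and_bounded F N θ₈.ν ⟨1, 0, 0⟩ (p := p) (EOfRecord₉ F N (stage9DeltaOfRecord F N θ₈))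
    (hw p) (hwb p) hw0 (hχ p) (fun k => hh p.K k)
  have hregT := fun p => slotsTOfRecord_measurable_and_bounded F N θ₈.ν ⟨1, 0, 0⟩ (p := p) (EOfRecord₉ F N (stage9DeltaOfRecord F N θ₈))
    (hw p) (hwb p) hw0 (hχ p) (fun k => hh p.K k)
  refine ⟨fun p k _ s => ?_, fun p k _ s t => hω p k s t, fun p k _ s' => hχ p (k + 1) s',
    isZetaUnity_zetaDeltaOfRecord F N θ₈.ν 1, isZetaAbsLeOne_zetaDeltaOfRecord F N θ₈.ν 1, fun p k _ hk => ?_⟩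
  · -- `intPiece`: a bounded measurable function on a probability space
    obtain ⟨hm, C, hC⟩ := hreg p k
    show Integrable (fun U => chiSeqOfRecord F N θ₈.ν 1 (gOfRecord₉ F N (stage9DeltaOfRecord F N θ₈) p) p.K k s U *
        slotsOfRecord F N θ₈.ν ⟨1, 0, 0⟩ (EOfRecord₉ F N (stage9DeltaOfRecord F N θ₈)) (wOfRecord₉ F N (stage9DeltaOfRecord F N θ₈))
          (ppSelIdOfRecord F θ₈.ν 1) p (gOfRecord₉ F N (stage9DeltaOfRecord F N θ₈) p) k s U) (fieldMeasure (F.P p.K) k (SU N))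
    have h0 : ∀ U, 0 ≤ chiSeqOfRecord F N θ₈.ν 1 (gOfRecord₉ F N (stage9DeltaOfRecord F N θ₈) p) p.K k s U *
        slotsOfRecord F N θ₈.ν ⟨1, 0, 0⟩ (EOfRecord₉ F N (stage9DeltaOfRecord F N θ₈)) (wOfRecord₉ F N (stage9DeltaOfRecord F N θ₈))
          (ppSelIdOfRecord F θ₈.ν 1) p (gOfRecord₉ F N (stage9DeltaOfRecord F N θ₈) p) k s U :=
      fun U => mul_nonneg (chiSeqOfRecord_nonneg F N θ₈.ν 1 _ p.K k s U) (slotsOfRecord_nonneg F N θ₈.ν ⟨1, 0, 0⟩ _ hw0 _ p _ k s U)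
    refine (integrable_const C).mono' (((hχ p k s).mul (hm s)).aestronglyMeasurable) (ae_of_all _ fun U => ?_)
    rw [Real.norm_eq_abs, abs_of_nonneg (h0 U)]
    exact (mul_le_of_le_one_left (slotsOfRecord_nonneg F N θ₈.ν ⟨1, 0, 0⟩ _ hw0 _ p _ k s U)
      (chiSeqOfRecord_le_one F N θ₈.ν 1 _ p.K k s U)).trans (hC s U)
  · -- `rstep`: the support-form (0.3) provisos of the pre-𝐑 tower at level `k + 1`
    obtain ⟨hmT, C, hC⟩ := hregT p k
    have hT0 : ∀ s V, 0 ≤ slotsTOfRecord F N θ₈.ν ⟨1, 0, 0⟩ (EOfRecord₉ F N (stage9DeltaOfRecord F N θ₈)) (wOfRecord₉ F N (stage9DeltaOfRecord F N θ₈))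
        (ppSelIdOfRecord F θ₈.ν 1) p (gOfRecord₉ F N (stage9DeltaOfRecord F N θ₈) p) (k + 1) s V :=
      slotsTOfRecord_nonneg F N θ₈.ν ⟨1, 0, 0⟩ _ hw0 _ p _ (k + 1)
    refine (provisosSupp_towerRepOfRecord_iff F N θ₈.ν ⟨1, 0, 0⟩ _ _ p _ (k + 1)).2
      ⟨fun s => (hχ p (k + 1) s).mul (hmT s), piece_nonneg_stage9DeltaOfRecord F θ₈ p (k + 1), ⟨C, fun s V => ?_⟩,
        fun s V h => hsupp p k s V h⟩
    exact (mul_le_of_le_one_left (hT0 s V) (chiSeqOfRecord_le_one F N θ₈.ν 1 _ p.K (k + 1) s V)).trans (hC s V)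

/-- **A STAGE-9 RECORD EXISTS AT EVERY `N` GIVEN THE FOUR CLAUSES** at the delta extension of an admissible Stage-8 parameter carrying the chart clause
of record (def-T's `exists_world_isRecordOfRecord₉C` at the reduced provisos).  A REDUCTION: the clauses are displayed hypotheses, none asserted;
K0 of record (plan: at `F 2`) is NOT discharged here. [cite: Balaban1989LargeFieldII, Thm 1 + (0.1) pp.355–356; Balaban1989LargeFieldI, (0.3)–(0.4) p.176 (bookkeeping)] -/
theorem exists_isRecordOfRecord₉C_of_regularity (θ₈ : Stage8Params F N) (hθ : θ₈.Admissible) (hch : θ₈.IsChartOfRecord 1)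
    (hχ : ∀ (p : B12.RunParams) (k : ℕ) (s : SeqOfRecord F θ₈.ν 1 (gOfRecord₉ F N (stage9DeltaOfRecord F N θ₈) p) p.K k),
      Measurable (chiSeqOfRecord F N θ₈.ν 1 (gOfRecord₉ F N (stage9DeltaOfRecord F N θ₈) p) p.K k s))
    (hω : ∀ (p : B12.RunParams) (k : ℕ) (s : SeqOfRecord F θ₈.ν 1 (gOfRecord₉ F N (stage9DeltaOfRecord F N θ₈) p) p.K k)
      (t : LbOfRecord F θ₈.ν p (gOfRecord₉ F N (stage9DeltaOfRecord F N θ₈) p) k),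
      Measurable (fun z : GaugeField (F.P p.K) (k + 1) (SU N) × GaugeField (F.P p.K) k (SU N) =>
        ωOfRecord F N θ₈.ν 1 p (gOfRecord₉ F N (stage9DeltaOfRecord F N θ₈) p) k 0 (zetaDeltaOfRecord F N θ₈.ν 1) s t z.2 z.1))
    (hh : ∀ K k : ℕ, ∃ C : ℝ, ∀ V', (avgDensity (avOfRecord F N K k).avg V' : ℝ) ≤ C)
    (hsupp : ∀ (p : B12.RunParams) (k : ℕ) [DecidableEq (PBond (F.P p.K) (k + 1))]
      (s : SeqOfRecord F θ₈.ν 1 (gOfRecord₉ F N (stage9DeltaOfRecord F N θ₈) p) p.K (k + 1)) (V : GaugeField (F.P p.K) (k + 1) (SU N)),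
      fibreIntegral (fibOfSeq F θ₈.ν ⟨1, 0, 0⟩ p (gOfRecord₉ F N (stage9DeltaOfRecord F N θ₈) p) (k + 1) s)
        (fun V => chiSeqOfRecord F N θ₈.ν 1 (gOfRecord₉ F N (stage9DeltaOfRecord F N θ₈) p) p.K (k + 1) s V *
          slotsTOfRecord F N θ₈.ν ⟨1, 0, 0⟩ (EOfRecord₉ F N (stage9DeltaOfRecord F N θ₈)) (wOfRecord₉ F N (stage9DeltaOfRecord F N θ₈))
            (ppSelIdOfRecord F θ₈.ν 1) p (gOfRecord₉ F N (stage9DeltaOfRecord F N θ₈) p) (k + 1) s V) V = 0 →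
      chiSeqOfRecord F N θ₈.ν 1 (gOfRecord₉ F N (stage9DeltaOfRecord F N θ₈) p) p.K (k + 1) s V *
        slotsTOfRecord F N θ₈.ν ⟨1, 0, 0⟩ (EOfRecord₉ F N (stage9DeltaOfRecord F N θ₈)) (wOfRecord₉ F N (stage9DeltaOfRecord F N θ₈))
          (ppSelIdOfRecord F θ₈.ν 1) p (gOfRecord₉ F N (stage9DeltaOfRecord F N θ₈) p) (k + 1) s V = 0) :
    ∃ (D : T4Continuum.FiniteEpsData F (SU N)) (w : WorldP), IsRecordOfRecord₉C F N D w ∧ w.γ = θ₈.γ := by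
  obtain ⟨w, hw, hwγ⟩ := exists_world_isRecordOfRecord₉C F N (stage9DeltaOfRecord F N θ₈)
    (provisos_stage9DeltaOfRecord_of_regularity F N θ₈ hχ hω hh hsupp) (admissible_stage9DeltaOfRecord F N hθ hch)
    (γw := θ₈.γ) ⟨hθ.1.1.2, le_rfl⟩
  exact ⟨_, w, hw, hwγ⟩

end Reduction

end Literature.MathematicalPhysics.QuantumFieldTheory.Balaban1983to89.Node00

end
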